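import Literature.Analysis.FluidPDE.OseenMildUniqueness
import HarnessLib

/-!
# Route ClockStretchingLaw — `SteadySliceLiouville`: stability of bounded solutions of the Oseen
# integral equation under a change of the free term

Helper file for item stmt-NavierStokesRegularity-10572 (`SteadySliceLiouville`) of route
`ClockStretchingLaw` of `NavierStokesRegularity`.

The tree proves *uniqueness* of bounded solutions of the Oseen integral equation
`u(t) = U(t) - B^ν_s(u,u)(t)` (`B^ν_s = oseenDuhamel ν s`; Koch–Nadirashvili–Seregin–Šverák 2009,
§4 (4.3)–(4.4); `Literature.Analysis.FluidPDE.oseenMild_bounded_unique`, through the key estimate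
`eLpNorm_sub_le_of_blocks`). The steady-slice Liouville lemma needs the corresponding
*continuous dependence on the free term* on a short window: if `u` and `v` are bounded by `M` on
`(s, T) × E` and solve `u = U - B(u,u)`, `v = V - B(v,v)` pointwise with `‖U - V‖ ≤ D`, then
`‖u(t) - v(t)‖ ≤ 2D` for `s < t ≤ s + η`, where the window `η > 0` depends only on `E`, `ν` and `M`.
The proof is the fixed-point iteration of KNSS 2009, §4 p. 8 with a source term: from
`‖u - v‖ ≤ S` on `(s, s + η]` one gets `‖u - v‖ ≤ D + A√η S ≤ D + S/2` (bilinear estimate (4.4),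
`exists_lintegral_enorm_oseenKernel_sub_le`), and iterating from the crude bound `S = 2M` gives
`‖u - v‖ ≤ 2D + 2M/2ⁿ` for every `n`.

* `norm_sub_le_of_oseenMild_freeTerm` — the one-step estimate (pointwise form of
  `eLpNorm_sub_le_of_blocks` with two free terms);
* `exists_oseenMild_stability_window` — the window `η(E, ν, M)` and the bound `‖u - v‖ ≤ 2D`.

## References

* G. Koch, N. Nadirashvili, G. Seregin, V. Šverák, *Liouville theorems for the Navier–Stokes
  equations and applications*, Acta Math. 203 (2009) 83–105 = arXiv:0709.3599, §4 (4.3)–(4.4).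
* Y. Giga, K. Inui, S. Matsui, *On the Cauchy problem for the Navier–Stokes equations with
  nondecaying initial data*, Quaderni di Matematica 4 (1999) 27–68.
-/

noncomputable section

open Literature.Analysis.FluidPDE MeasureTheory Set Function Filter Topology
open scoped ENNReal NNReal

namespace Summit.NavierStokesRegularity.NavierStokesRegularity.Theorems

variable {E : Type*} [NormedAddCommGroup E] [InnerProductSpace ℝ E] [FiniteDimensional ℝ E]
  [MeasurableSpace E] [BorelSpace E]

variable {ν s T M : ℝ} {U V u v : ℝ → E → E}

/-- **One-step stability estimate for the Oseen integral equation with two free terms**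
(pointwise form of `Literature.Analysis.FluidPDE.eLpNorm_sub_le_of_blocks`; KNSS 2009, §4
(4.3)–(4.4)). Let `u`, `v` be jointly measurable and bounded by `M` on `(s, T) × E`, and solve
`u(t) = U(t) - B^ν_s(u,u)(t)`, `v(t) = V(t) - B^ν_s(v,v)(t)` pointwise for `t ∈ (s, T)`, with
`‖U(t) - V(t)‖ ≤ D` there. If `‖u(τ) - v(τ)‖ ≤ S` for `τ ≤ β`, then for `s < t ≤ β` (`t < T`),
`‖u(t,x) - v(t,x)‖ ≤ D + 4 C M ν^{-1/2} √(β - s) S`, with the constant `C` of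
`exists_lintegral_enorm_oseenKernel_sub_le`. -/
theorem norm_sub_le_of_oseenMild_freeTerm {C : ℝ}
    (hCK : ∀ {σ : ℝ}, 0 < σ → ∀ {a a' b b' : E → E} {M S : ℝ}, 0 ≤ M → 0 ≤ S →
      (∀ y, ‖a' y‖ ≤ M) → (∀ y, ‖b y‖ ≤ M) →
      (∀ᵐ y ∂(volume : Measure E), ‖a y - a' y‖ ≤ S) →
      (∀ᵐ y ∂(volume : Measure E), ‖b y - b' y‖ ≤ S) → ∀ x : E,
        ∫⁻ y, ‖oseenKernel σ (x - y) (a y) (b y) - oseenKernel σ (x - y) (a' y) (b' y)‖ₑ ≤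
          ENNReal.ofReal (C * σ ^ (-(1 / 2 : ℝ)) * (2 * M * S)))
    (hC : 0 < C) (hν : 0 < ν) (hM : 0 ≤ M)
    (hum : AEStronglyMeasurable (uncurry u) ((volume : Measure (ℝ × E)).restrict (Ioo s T ×ˢ univ)))
    (hvm : AEStronglyMeasurable (uncurry v) ((volume : Measure (ℝ × E)).restrict (Ioo s T ×ˢ univ)))
    (huM : ∀ τ ∈ Ioo s T, ∀ y, ‖u τ y‖ ≤ M) (hvM : ∀ τ ∈ Ioo s T, ∀ y, ‖v τ y‖ ≤ M)
    (hu : ∀ t ∈ Ioo s T, ∀ x, u t x = U t x - oseenDuhamel ν s u u t x)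
    (hv : ∀ t ∈ Ioo s T, ∀ x, v t x = V t x - oseenDuhamel ν s v v t x)
    {D : ℝ} (hUV : ∀ t ∈ Ioo s T, ∀ x, ‖U t x - V t x‖ ≤ D)
    {β S : ℝ} (hS : 0 ≤ S) (hβ : ∀ τ ∈ Ioo s T, τ ≤ β → ∀ y, ‖u τ y - v τ y‖ ≤ S)
    {t : ℝ} (ht : t ∈ Ioo s T) (htβ : t ≤ β) (x : E) :
    ‖u t x - v t x‖ ≤ D + 4 * C * M * ν ^ (-(1 / 2 : ℝ)) * Real.sqrt (β - s) * S := by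
  have hst : s < t := ht.1
  -- the Duhamel integrands and their integrability on `(s, t) × E`
  have hIu : Integrable
      (fun p : ℝ × E => oseenKernel (ν * (t - p.1)) (x - p.2) (u p.1 p.2) (u p.1 p.2))
      ((volume.restrict (Ioo s t)).prod (volume : Measure E)) := by
    rw [← volume_restrict_prod_univ_eq_prod]
    exact integrable_oseenKernel_duhamel_bounded hν hum hum hM huM huM hst ht.2.le x
  have hIv : Integrable
      (fun p : ℝ × E => oseenKernel (ν * (t - p.1)) (x - p.2) (v p.1 p.2) (v p.1 p.2))
      ((volume.restrict (Ioo s t)).prod (volume : Measure E)) := by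
    rw [← volume_restrict_prod_univ_eq_prod]
    exact integrable_oseenKernel_duhamel_bounded hν hvm hvm hM hvM hvM hst ht.2.le x
  set K₁ : ℝ := C * ν ^ (-(1 / 2 : ℝ)) * (2 * M * S) with hK₁
  have hK₁0 : 0 ≤ K₁ := by positivity
  set R : ℝ := 4 * C * M * ν ^ (-(1 / 2 : ℝ)) * Real.sqrt (β - s) * S with hR
  have hR0 : 0 ≤ R := by positivity
  -- the bound on the difference of the Duhamel terms at `x`
  have hdiff : ‖oseenDuhamel ν s u u t x - oseenDuhamel ν s v v t x‖ₑ ≤ ENNReal.ofReal R := by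
    have hu1 := hIu.integral_prod_left
    have hv1 := hIv.integral_prod_left
    have hsub : oseenDuhamel ν s u u t x - oseenDuhamel ν s v v t x =
        ∫ τ in Ioo s t, ((∫ y, oseenKernel (ν * (t - τ)) (x - y) (u τ y) (u τ y)) -
          ∫ y, oseenKernel (ν * (t - τ)) (x - y) (v τ y) (v τ y)) := by
      rw [oseenDuhamel, oseenDuhamel, ← integral_sub hu1 hv1]
    have hae_u := hIu.prod_right_ae
    have hae_v := hIv.prod_right_ae
    have hbound : ∀ᵐ τ ∂(volume.restrict (Ioo s t)),
        ‖(∫ y, oseenKernel (ν * (t - τ)) (x - y) (u τ y) (u τ y)) -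
            ∫ y, oseenKernel (ν * (t - τ)) (x - y) (v τ y) (v τ y)‖ₑ ≤
          ENNReal.ofReal K₁ * ENNReal.ofReal ((t - τ) ^ (-(1 / 2 : ℝ))) := by
      filter_upwards [hae_u, hae_v, ae_restrict_mem measurableSet_Ioo] with τ hτu hτv hτ
      have hτT : τ ∈ Ioo s T := ⟨hτ.1, hτ.2.trans ht.2⟩
      rw [← integral_sub hτu hτv]
      have hσ : 0 < ν * (t - τ) := mul_pos hν (sub_pos.2 hτ.2)
      have hτβ : τ ≤ β := hτ.2.le.trans htβ
      have hSτ : ∀ᵐ y ∂(volume : Measure E), ‖u τ y - v τ y‖ ≤ S :=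
        Eventually.of_forall (hβ τ hτT hτβ)
      calc ‖∫ y, (oseenKernel (ν * (t - τ)) (x - y) (u τ y) (u τ y) -
              oseenKernel (ν * (t - τ)) (x - y) (v τ y) (v τ y))‖ₑ
          ≤ ∫⁻ y, ‖oseenKernel (ν * (t - τ)) (x - y) (u τ y) (u τ y) -
              oseenKernel (ν * (t - τ)) (x - y) (v τ y) (v τ y)‖ₑ :=
            enorm_integral_le_lintegral_enorm _
        _ ≤ ENNReal.ofReal (C * (ν * (t - τ)) ^ (-(1 / 2 : ℝ)) * (2 * M * S)) :=
            hCK hσ hM hS (hvM τ hτT) (huM τ hτT) hSτ hSτ x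
        _ = ENNReal.ofReal K₁ * ENNReal.ofReal ((t - τ) ^ (-(1 / 2 : ℝ))) := by
            rw [← ENNReal.ofReal_mul hK₁0]
            congr 1
            rw [hK₁, Real.mul_rpow hν.le (sub_pos.2 hτ.2).le]
            ring
    calc ‖oseenDuhamel ν s u u t x - oseenDuhamel ν s v v t x‖ₑ
        = ‖∫ τ in Ioo s t, ((∫ y, oseenKernel (ν * (t - τ)) (x - y) (u τ y) (u τ y)) -
            ∫ y, oseenKernel (ν * (t - τ)) (x - y) (v τ y) (v τ y))‖ₑ := by rw [hsub]
      _ ≤ ∫⁻ τ in Ioo s t, ‖(∫ y, oseenKernel (ν * (t - τ)) (x - y) (u τ y) (u τ y)) -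
            ∫ y, oseenKernel (ν * (t - τ)) (x - y) (v τ y) (v τ y)‖ₑ :=
          enorm_integral_le_lintegral_enorm _
      _ ≤ ∫⁻ τ in Ioo s t, ENNReal.ofReal K₁ * ENNReal.ofReal ((t - τ) ^ (-(1 / 2 : ℝ))) :=
          lintegral_mono_ae hbound
      _ = ENNReal.ofReal K₁ * ENNReal.ofReal (2 * Real.sqrt (t - s)) := by
          rw [lintegral_const_mul' _ _ ENNReal.ofReal_ne_top,
            setLIntegral_Ioo_sub_rpow_neg_half_of_lt hst]
      _ ≤ ENNReal.ofReal K₁ * ENNReal.ofReal (2 * Real.sqrt (β - s)) := by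
          gcongr
      _ = ENNReal.ofReal R := by
          rw [← ENNReal.ofReal_mul hK₁0, hK₁, hR]
          ring_nf
  have hdiff' : ‖oseenDuhamel ν s u u t x - oseenDuhamel ν s v v t x‖ ≤ R := by
    rw [← ofReal_norm] at hdiff
    exact (ENNReal.ofReal_le_ofReal_iff hR0).1 hdiff
  rw [hu t ht x, hv t ht x, sub_sub_sub_comm]
  calc ‖U t x - V t x - (oseenDuhamel ν s u u t x - oseenDuhamel ν s v v t x)‖
      ≤ ‖U t x - V t x‖ + ‖oseenDuhamel ν s u u t x - oseenDuhamel ν s v v t x‖ := norm_sub_le _ _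
    _ ≤ D + R := add_le_add (hUV t ht x) hdiff'

variable (E) in
/-- **Continuous dependence on the free term on a short window** (KNSS 2009, §4 p. 8: the
integral equation "can be solved in `L^∞_{x,t}` for sufficiently small `T` by a fixed point
argument"; Giga–Inui–Matsui 1999). For `ν > 0` and `M ≥ 0` there is `η = η(E, ν, M) > 0` such
that: whenever `u`, `v` are jointly measurable and bounded by `M` on `(s, T) × E` and solve
`u(t) = U(t) - B^ν_s(u,u)(t)`, `v(t) = V(t) - B^ν_s(v,v)(t)` pointwise for `t ∈ (s, T)` with
`‖U(t,x) - V(t,x)‖ ≤ D`, then `‖u(t,x) - v(t,x)‖ ≤ 2D` for all `s < t ≤ s + η` (`t < T`) and all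
`x`. Proof: with `A = 4CMν^{-1/2}` and `A√η ≤ 1/2`, the one-step estimate turns the bound
`‖u - v‖ ≤ 2D + 2M/2ⁿ` on `(s, s + η]` into `‖u - v‖ ≤ D + (2D + 2M/2ⁿ)/2 = 2D + 2M/2ⁿ⁺¹`;
start from the crude bound `2M` and let `n → ∞`. -/
theorem exists_oseenMild_stability_window (hν : 0 < ν) (hM : 0 ≤ M) :
    ∃ η : ℝ, 0 < η ∧ ∀ {s T : ℝ} {U V u v : ℝ → E → E},
      AEStronglyMeasurable (uncurry u) ((volume : Measure (ℝ × E)).restrict (Ioo s T ×ˢ univ)) →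
      AEStronglyMeasurable (uncurry v) ((volume : Measure (ℝ × E)).restrict (Ioo s T ×ˢ univ)) →
      (∀ τ ∈ Ioo s T, ∀ y, ‖u τ y‖ ≤ M) → (∀ τ ∈ Ioo s T, ∀ y, ‖v τ y‖ ≤ M) →
      (∀ t ∈ Ioo s T, ∀ x, u t x = U t x - oseenDuhamel ν s u u t x) →
      (∀ t ∈ Ioo s T, ∀ x, v t x = V t x - oseenDuhamel ν s v v t x) →
      ∀ {D : ℝ}, 0 ≤ D → (∀ t ∈ Ioo s T, ∀ x, ‖U t x - V t x‖ ≤ D) →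
      ∀ t ∈ Ioo s T, t ≤ s + η → ∀ x, ‖u t x - v t x‖ ≤ 2 * D := by
  obtain ⟨C, hC, hCK⟩ := exists_lintegral_enorm_oseenKernel_sub_le (E := E)
  -- window length `η` with `4 C M ν^{-1/2} √η ≤ 1/2`
  set A : ℝ := 4 * C * M * ν ^ (-(1 / 2 : ℝ)) with hA
  have hA0 : 0 ≤ A := by positivity
  set η : ℝ := 1 / (4 * A ^ 2 + 1) with hη
  have hη0 : 0 < η := by positivity
  have hq : A * Real.sqrt η ≤ 1 / 2 := by
    have h1 : A * Real.sqrt η = Real.sqrt (A ^ 2 * η) := by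
      rw [Real.sqrt_mul (sq_nonneg A), Real.sqrt_sq hA0]
    rw [h1, Real.sqrt_le_left (by norm_num)]
    rw [hη, div_eq_mul_inv, ← mul_assoc, mul_inv_le_iff₀ (by positivity)]
    nlinarith [sq_nonneg A]
  refine ⟨η, hη0, ?_⟩
  intro s T U V u v hum hvm huM hvM hu hv D hD hUV
  -- the distance bound improves from `2M` to `2D + 2M/2ⁿ`
  have hiter : ∀ n : ℕ, ∀ t ∈ Ioo s T, t ≤ s + η → ∀ x, ‖u t x - v t x‖ ≤ 2 * D + 2 * M / 2 ^ n := by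
    intro n
    induction n with
    | zero =>
      intro t ht _ x
      calc ‖u t x - v t x‖ ≤ ‖u t x‖ + ‖v t x‖ := norm_sub_le _ _
        _ ≤ M + M := add_le_add (huM t ht x) (hvM t ht x)
        _ ≤ 2 * D + 2 * M / 2 ^ 0 := by rw [pow_zero, div_one]; linarith
    | succ n ih =>
      intro t ht htη x
      have hS : 0 ≤ 2 * D + 2 * M / 2 ^ n := by positivity
      have h := norm_sub_le_of_oseenMild_freeTerm hCK hC hν hM hum hvm huM hvM hu hv hUV hS
        (fun τ hτ hτη y => ih τ hτ hτη y) ht htη x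
      rw [add_sub_cancel_left] at h
      calc ‖u t x - v t x‖
          ≤ D + 4 * C * M * ν ^ (-(1 / 2 : ℝ)) * Real.sqrt η * (2 * D + 2 * M / 2 ^ n) := h
        _ = D + A * Real.sqrt η * (2 * D + 2 * M / 2 ^ n) := by rw [hA]
        _ ≤ D + 1 / 2 * (2 * D + 2 * M / 2 ^ n) := by
            linarith [mul_le_mul_of_nonneg_right hq hS]
        _ = 2 * D + 2 * M / 2 ^ (n + 1) := by rw [pow_succ]; ring
  intro t ht htη x
  have hlim : Tendsto (fun n : ℕ => 2 * D + 2 * M / 2 ^ n) atTop (𝓝 (2 * D)) := by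
    have h := (tendsto_pow_atTop_nhds_zero_of_lt_one (by norm_num : (0 : ℝ) ≤ 1 / 2)
      (by norm_num : (1 / 2 : ℝ) < 1)).const_mul (2 * M)
    rw [mul_zero] at h
    have h2 := h.const_add (2 * D)
    rw [add_zero] at h2
    refine h2.congr fun n => ?_
    rw [one_div, inv_pow, div_eq_mul_inv]
  exact ge_of_tendsto' hlim fun n => hiter n t ht htη x

end Summit.NavierStokesRegularity.NavierStokesRegularity.Theorems

end
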